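import Mathlib.RingTheory.Valuation.ValuativeRel.Basic    -- `ValuativeRel.valuation` (Mathlib-only footing)
import Mathlib.Tactic
import HarnessLib

/-!
# The Eisenstein-centre dictionary of the wild type-(2) eigen-field package: `a = (t + y)·e₂`, `f := t − 2a = −y = D·s(a) − a`, `−χ(a) = y²·w₀·e₂²`

Topic `NumberTheory/Rogawski1990`; namespace `Literature.NumberTheory.Rogawski1990`.  THEOREMS ONLY (no definition, no instance, no notation, no named fact, no `sorry`);
Mathlib-only imports.  Cell `pub/hodgecm-mathlib`, F0∕P3c LH4 list: the dictionary between ★ p851792 `TypeTwoEigenFieldPackageWild.exists_eigenField_package_wildUnit`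
(eigenvalue `λ₁ = (t + y·α)·e₂`, `e₂·2 = 1`, `α² = d = 1 + w₀`, `4D = t² − y²d`, `s t = t·sD`, `s y = −y·sD`, `D·sD = 1`) and the Eisenstein-centred consumers
(★ p851800 ∕ ★ p851815 frame + centre trace, ★ p851805 affine strata, the affine star∕edge counts): binders token-parallel to ★ p851792 :40–:44 (LH4-plan (g6) 15:07Z (3)).
HC_CM is proved only modulo the printed citations until rung 0 closes; this file is unconditional, elementary and 2-free as a HYPOTHESIS (`e₂` is an inverse of `2` in the
field, which exists in characteristic `0`; no valuation of `2` is read).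

THE DICTIONARY.  In the `(1, Π)`-coordinates of `𝒪_{K₂} = 𝒪 ⊕ 𝒪·Π`, `Π = (α − 1)∕ι₁ϖ^k` (★ p851611), the eigenvalue `λ₁ = (t + yα)e₂ = a + b·Π` has CENTRE
**`a = (t + y)·e₂`** (and `b = y·ι₁ϖ^k·e₂`).  Then (D1) `t − 2a = −y`; (D2) `D·s(a) − a = −y` (from `s t = t·sD`, `s y = −y·sD`, `D·sD = 1`, `s e₂ = e₂`) — so the centre-trace
input `|D·s a − a| ≤ |ϖ^(j+1)|` of ★ p851815 `valuation_antidiagTrace_le` IS the sharp trace hypothesis `|f| ≤ |ϖ^(j+1)|`, `f := t − 2a`, of the affine counts (the skew generator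
of ★ p851792 is `s′`-fixed, so the exact form `D·s a = a` fails at a wild unit row: `D·s a − a = −y ≠ 0`); (D3) `a² − t·a + D = −y²(d − 1)e₂² = −y²w₀e₂²`, i.e. the affine constant
`e′ := −χ(a) = y²w₀e₂²` with `|e′| = |y|²|w₀|∕|4|`.

* §1 (any field `K`, `s : K →+* K`) `map_halfInv_eq`, `trace_sub_two_mul_centre`, `map_centre_eq`, `det_mul_map_centre_sub_centre`, `det_mul_map_centre_sub_centre_eq_trace_sub`,
  `centre_mul_centre_sub_eq`, `centre_mul_centre_sub_eq_of_eq_one_add`.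
* §2 (`[ValuativeRel K]`) `valuation_det_mul_map_centre_sub_centre`, `valuation_trace_sub_two_mul_centre` (both `= valuation K y`).

## References
* [Rogawski1990] J. D. Rogawski, *Automorphic Representations of Unitary Groups in Three Variables* (1990), §4.9 Lemma 4.9.3 p. 56; §3.6 p. 31.
* [Serre1979] J.-P. Serre, *Local Fields*, GTM 67 (1979), Ch. I §6 Prop. 17–18 (Eisenstein equations).
* [Jacobowitz1962] R. Jacobowitz, *Hermitian forms over local fields*, Amer. J. Math. 84 (1962), §§9–11.
-/

set_option autoImplicit false

noncomputable section

open ValuativeRel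
open scoped ValuativeRel

namespace Literature.NumberTheory.Rogawski1990

/-! ## §1 The centre `a = (t + y)·e₂` (any field) -/

section Algebra

variable {K : Type*} [Field K] (s : K →+* K)

/-- **`s` fixes the half**: `e₂·2 = 1 ⇒ s e₂ = e₂` (`s e₂` is again an inverse of `2`). [cite: Rogawski1990, §4.9 Lemma 4.9.3 p. 56] -/
theorem map_halfInv_eq {e₂ : K} (h2e : e₂ * 2 = 1) : s e₂ = e₂ := by
  have h2 : (2 : K) ≠ 0 := fun h => by rw [h, mul_zero] at h2e; exact zero_ne_one h2e
  have hs : s e₂ * 2 = 1 := by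
    have := congrArg s h2e
    rwa [map_mul, map_ofNat, map_one] at this
  exact mul_right_cancel₀ h2 (hs.trans h2e.symm)

/-- **(D1) the affine trace coefficient**: `t − 2·((t + y)e₂) = −y` (`e₂·2 = 1`): `f := t − 2a = −y` for the centre `a = (t + y)e₂` of `λ₁ = (t + yα)e₂`.
[cite: Rogawski1990, §4.9 Lemma 4.9.3 p. 56] [cite: Serre1979, Ch. I §6 Prop. 17–18] -/
theorem trace_sub_two_mul_centre {t y e₂ : K} (h2e : e₂ * 2 = 1) : t - 2 * ((t + y) * e₂) = -y := by
  linear_combination (-(t + y)) * h2e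

/-- **`s` of the centre**: `s((t + y)e₂) = sD·(t − y)·e₂` from `s t = t·sD`, `s y = −y·sD`, `s e₂ = e₂`. [cite: Rogawski1990, §4.9 Lemma 4.9.3 p. 56] -/
theorem map_centre_eq {t y D e₂ : K} (h2e : e₂ * 2 = 1) (hσt : s t = t * s D) (hσy : s y = -(y * s D)) :
    s ((t + y) * e₂) = s D * (t - y) * e₂ := by
  rw [map_mul, map_add, hσt, hσy, map_halfInv_eq s h2e]
  ring

/-- **(D2) the centre-trace input**: `D·s((t + y)e₂) − (t + y)e₂ = −y` (from `s t = t·sD`, `s y = −y·sD`, `D·sD = 1`, `e₂·2 = 1`) — the element whose valuation ★ p851815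
`valuation_antidiagTrace_le` reads; it equals the affine trace coefficient `f = t − 2a` (next lemma). [cite: Rogawski1990, §4.9 Lemma 4.9.3 p. 56] [cite: Jacobowitz1962, §§9–11] -/
theorem det_mul_map_centre_sub_centre {t y D e₂ : K} (h2e : e₂ * 2 = 1) (hσD : D * s D = 1) (hσt : s t = t * s D) (hσy : s y = -(y * s D)) :
    D * s ((t + y) * e₂) - (t + y) * e₂ = -y := by
  rw [map_centre_eq s h2e hσt hσy]
  linear_combination ((t - y) * e₂) * hσD - y * h2e

/-- **(D2′) `D·s(a) − a = t − 2a`** for the package centre `a = (t + y)e₂`: the centre-trace input IS the affine trace coefficient. [cite: Rogawski1990, §4.9 Lemma 4.9.3 p. 56] -/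
theorem det_mul_map_centre_sub_centre_eq_trace_sub {t y D e₂ : K} (h2e : e₂ * 2 = 1) (hσD : D * s D = 1) (hσt : s t = t * s D) (hσy : s y = -(y * s D)) :
    D * s ((t + y) * e₂) - (t + y) * e₂ = t - 2 * ((t + y) * e₂) := by
  rw [det_mul_map_centre_sub_centre s h2e hσD hσt hσy, trace_sub_two_mul_centre h2e]

/-- **(D3) the affine constant**: `a² − t·a + D = −(y²(d − 1))·e₂²` for `a = (t + y)e₂`, from `4D = t² − y²d` (`e₂·2 = 1`): `e′ := −χ(a) = y²(d − 1)∕4`.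
[cite: Rogawski1990, §4.9 Lemma 4.9.3 p. 56] [cite: Serre1979, Ch. I §6 Prop. 17–18] -/
theorem centre_mul_centre_sub_eq {t y D d e₂ : K} (h2e : e₂ * 2 = 1) (hD : 4 * D = t * t - y * y * d) :
    (t + y) * e₂ * ((t + y) * e₂) - t * ((t + y) * e₂) + D = -(y * y * (d - 1)) * (e₂ * e₂) := by
  linear_combination (e₂ * e₂) * hD + (t * t * e₂ + t * y * e₂ - D * (2 * e₂ + 1)) * h2e

/-- **(D3′) with `d = 1 + w₀`**: `a² − t·a + D = −(y²w₀)·e₂²`, i.e. `e′ = −χ(a) = y²w₀e₂²`. [cite: Rogawski1990, §4.9 Lemma 4.9.3 p. 56] [cite: Serre1979, Ch. I §6 Prop. 17–18] -/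
theorem centre_mul_centre_sub_eq_of_eq_one_add {t y D d w₀ e₂ : K} (h2e : e₂ * 2 = 1) (hD : 4 * D = t * t - y * y * d) (hdw : d = 1 + w₀) :
    (t + y) * e₂ * ((t + y) * e₂) - t * ((t + y) * e₂) + D = -(y * y * w₀) * (e₂ * e₂) := by
  rw [centre_mul_centre_sub_eq h2e hD, hdw, add_sub_cancel_left]

end Algebra

/-! ## §2 Valuations: both `|D·s a − a|` and `|t − 2a|` are `|y|` -/

section Valued

variable {K : Type*} [Field K] [ValuativeRel K] (s : K →+* K)

/-- **`|D·s(a) − a| = |y|`** for the package centre. [cite: Rogawski1990, §4.9 Lemma 4.9.3 p. 56] -/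
theorem valuation_det_mul_map_centre_sub_centre {t y D e₂ : K} (h2e : e₂ * 2 = 1) (hσD : D * s D = 1) (hσt : s t = t * s D) (hσy : s y = -(y * s D)) :
    valuation K (D * s ((t + y) * e₂) - (t + y) * e₂) = valuation K y := by
  rw [det_mul_map_centre_sub_centre s h2e hσD hσt hσy, Valuation.map_neg]

/-- **`|t − 2a| = |y|`** for the package centre. [cite: Rogawski1990, §4.9 Lemma 4.9.3 p. 56] -/
theorem valuation_trace_sub_two_mul_centre {t y e₂ : K} (h2e : e₂ * 2 = 1) :
    valuation K (t - 2 * ((t + y) * e₂)) = valuation K y := by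
  rw [trace_sub_two_mul_centre h2e, Valuation.map_neg]

end Valued

end Literature.NumberTheory.Rogawski1990
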